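import Summits.ResolutionOfSingularities.ResolutionOfSingularities.Theorems.HilbertSamuelEliminationCampaignW42ConeRidgeDimPrime
import HarnessLib

/-!
# [OURS · L1 W4.2] The second face of the thickening, `B/E₂B ≅ (L[X]/I_L)_{𝔪_{x̄}}`, WITH ITS ACTION ON `T[Y]` (campaign s42, cell
# res-hironaka; informal crux `RidgeConfinement`, stmt-ResolutionOfSingularities-17845; `--supports`; brick D3b of the directrix form
# of CJS Thm. 3.10 (4))

HONEST FRAMING. OURS (slot W4.2, prover res-L1-s42-pv-1, gen 6). [OURS · L1 W4.2] replaces the role of nothing printed in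
H. Hironaka's manuscript. The tree's `nonempty_ringEquiv_thickening_mod_regular` (`…CampaignW42ConePointResidueRational`, gen 5)
gives the isomorphism of the second face of the thickening `B = (T[Y])_𝔔` of `O_{C,𝔓}` with the local ring of the cone `C_L` at
its `L`-rational point `x̄` only up to existence; the directrix chain needs to know what it does to the image of `T[Y]` (so that
the augmentations to `L` on both sides match). `exists_ringEquiv_thickening_mod_regular` re-derives it together with the formula
`ē(p̄) = G₁(p)`, `G₁ : T[Y] → L[X]/I_L` the swap (coefficients through `K → L`, `Y_i ↦ x̄_i`).

NOT a statement of H. Hironaka's manuscript [Hironaka2017]. AI review is weaker than expert review. References (orientation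
only): B. Dietel, Dissertation Regensburg (2015), Satz (8.2.7) p. 105, (8.1.3), (8.2.3)–(8.2.6); V. Cossart, U. Jannsen, S. Saito,
LNM 2270 (2020), Thm. 3.10 (4), proof p. 46–50; J. Giraud, *Bull. Sci. Math.* 99 (1975) §1.5.
-/

noncomputable section

-- single-conjunct summit: the doubled namespace component `ResolutionOfSingularities` is mandated
set_option linter.dupNamespace false
-- localizations of polynomial rings over quotient rings: nested instance problems (as in the gen-3/4/5 files)
set_option maxSynthPendingDepth 3

open IsLocalRing MvPolynomial Module
open Literature.RingTheory.HilbertSamuel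
open Literature.RingTheory.MvPolynomial (idealDegree shift directrixDim)
open Literature.AlgebraicGeometry.Resolution

namespace Summit.ResolutionOfSingularities.ResolutionOfSingularities.Theorems

namespace CampaignW42

universe u

/-! ## The chain for `e(·)_K` at the concrete local ring `O = T_{𝔓/I}` -/

section Structure

variable {K : Type u} [Field K] {n : ℕ} {I 𝔓 : Ideal (MvPolynomial (Fin n) K)} (hI𝔓 : I ≤ 𝔓)
  (L : Type u) [Field L] [Algebra (MvPolynomial (Fin n) K ⧸ 𝔓) L] [IsFractionRing (MvPolynomial (Fin n) K ⧸ 𝔓) L]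
  {Q : Ideal (MvPolynomial (Fin n) (MvPolynomial (Fin n) K ⧸ I))} [Q.IsPrime]
  (hQ : Q = RingHom.ker (eval₂Hom ((algebraMap (MvPolynomial (Fin n) K ⧸ 𝔓) L).comp (Ideal.Quotient.factor hI𝔓))
    (fun i : Fin n => algebraMap (MvPolynomial (Fin n) K ⧸ 𝔓) L (Ideal.Quotient.mk 𝔓 (X i)))))
  [𝔓.IsPrime] {P' : Ideal (MvPolynomial (Fin n) K ⧸ I)} [P'.IsPrime] (hP' : P' = 𝔓.map (Ideal.Quotient.mk I))

/-- [notation] `T = S/I`, the coordinate ring of the cone. -/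
local notation3 "T" => MvPolynomial (Fin n) K ⧸ I
/-- [notation] `D = S/𝔓`. -/
local notation3 "D" => MvPolynomial (Fin n) K ⧸ 𝔓
/-- [notation] `x̄ ∈ Lⁿ`, the images of the variables. -/
local notation3 "xbar" => fun i : Fin n => algebraMap (MvPolynomial (Fin n) K ⧸ 𝔓) L (Ideal.Quotient.mk 𝔓 (X i))
/-- [notation] `φ : T → D → L`. -/
local notation3 "φ" => (algebraMap (MvPolynomial (Fin n) K ⧸ 𝔓) L).comp (Ideal.Quotient.factor hI𝔓)
/-- [notation] `ψ : T[Y] → L`. -/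
local notation3 "ψ" => eval₂Hom ((algebraMap (MvPolynomial (Fin n) K ⧸ 𝔓) L).comp (Ideal.Quotient.factor hI𝔓)) xbar
/-- [notation] `I_D = I · D[X]`. -/
local notation3 "ID" => I.map (MvPolynomial.map (algebraMap K (MvPolynomial (Fin n) K ⧸ 𝔓)))
/-- [notation] `I_L = I · L[X]`, written as in `…ConePointResidueRational` (through `D[X] → L[X]`). -/
local notation3 "IL" => (I.map (MvPolynomial.map (algebraMap K (MvPolynomial (Fin n) K ⧸ 𝔓)))).map
  (@algebraMap (MvPolynomial (Fin n) (MvPolynomial (Fin n) K ⧸ 𝔓)) (MvPolynomial (Fin n) L) _ _ MvPolynomial.algebraMvPolynomial)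
/-- [notation] `ι₂ : S = K[Y] → T[Y]`. -/
local notation3 "ι₂" => MvPolynomial.map (σ := Fin n) (algebraMap K (MvPolynomial (Fin n) K ⧸ I))
/-- [notation] `E₂ = 𝔓(Y) · T[Y]`. -/
local notation3 "E₂" => 𝔓.map ι₂
/-- [notation] the thickening `B = (T[Y])_𝔔`. -/
local notation3 "B" => Localization.AtPrime Q
/-- [notation] `O = O_{C,𝔓}`. -/
local notation3 "O" => Localization.AtPrime P'
/-- [notation] `Rp = S_𝔓`, the regular side. -/
local notation3 "Rp" => Localization.AtPrime 𝔓
/-- [notation] `θ₂ : Rp → B`, the structure map of the regular side. -/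
local notation3 "θ₂" => Localization.localRingHom 𝔓 Q (MvPolynomial.map (σ := Fin n) (algebraMap K (MvPolynomial (Fin n) K ⧸ I)))
  (prime_eq_comap_ι₂ hI𝔓 L hQ)
/-- [notation] the forward swap map `f₁ : T[Y] → D[X]/I_D`. -/
local notation3 "f₁" => eval₂Hom (Ideal.Quotient.lift I ((Ideal.Quotient.mk ID).comp
    (MvPolynomial.map (algebraMap K D))) (fun _ hq => le_ker_mk_comp_map hq))
    (fun i => Ideal.Quotient.mk ID (C (Ideal.Quotient.mk 𝔓 (X i))))

omit [IsFractionRing (MvPolynomial (Fin n) K ⧸ 𝔓) L] [𝔓.IsPrime] in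
/-- `I ⊆ ker(S → L[X]/I_L)` along `K → D → L`. [folklore] -/
theorem le_ker_mk_comp_map_coneIdealL :
    I ≤ RingHom.ker ((Ideal.Quotient.mk IL).comp (MvPolynomial.map ((algebraMap D L).comp (algebraMap K D)))) := by
  intro a ha
  rw [RingHom.mem_ker, RingHom.comp_apply, Ideal.Quotient.eq_zero_iff_mem, coneIdealL_eq_map (I := I) (𝔓 := 𝔓) L]
  exact Ideal.mem_map_of_mem _ ha

/-- [notation] `G₁ : T[Y] → L[X]/I_L`, the swap followed by `D[X]/I_D → L[X]/I_L` (coefficients through `K → L`,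
`Y_i ↦ x̄_i`). -/
local notation3 "G₁" => eval₂Hom (Ideal.Quotient.lift I ((Ideal.Quotient.mk IL).comp
    (MvPolynomial.map ((algebraMap D L).comp (algebraMap K D)))) (fun _ hq => le_ker_mk_comp_map_coneIdealL L hq))
    (fun i => Ideal.Quotient.mk IL (C (algebraMap (MvPolynomial (Fin n) K ⧸ 𝔓) L (Ideal.Quotient.mk 𝔓 (X i)))))

omit [𝔓.IsPrime] in
include hQ in
-- (`maxHeartbeats`: towers of localizations of polynomial rings over quotient rings; instance unification is slow here)
set_option maxHeartbeats 800000 in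
/-- **`B/E₂B ≅ (L[X]/I_L)_{𝔪_{x̄}}`, WITH ITS ACTION ON `T[Y]`**: the tree's isomorphism
`nonempty_ringEquiv_thickening_mod_regular`, re-derived together with the formula `ē(p̄) = G₁(p)` (the swap, read in
`L[X]/I_L`) on the image of `p ∈ T[Y]`. [cite: Dietel2015, (8.2.3), (8.2.6.2)] -/
theorem exists_ringEquiv_thickening_mod_regular
    [hQL : ((RingHom.ker (eval xbar) : Ideal (MvPolynomial (Fin n) L)).map (Ideal.Quotient.mk
      ((ID).map (@algebraMap (MvPolynomial (Fin n) (MvPolynomial (Fin n) K ⧸ 𝔓)) (MvPolynomial (Fin n) L) _ _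
        MvPolynomial.algebraMvPolynomial)))).IsPrime] :
    ∃ ē : (B ⧸ (E₂).map (algebraMap (MvPolynomial (Fin n) T) B)) ≃+*
      Localization.AtPrime ((RingHom.ker (eval xbar) : Ideal (MvPolynomial (Fin n) L)).map (Ideal.Quotient.mk IL)),
      ∀ p : MvPolynomial (Fin n) T, ē (Ideal.Quotient.mk _ (algebraMap (MvPolynomial (Fin n) T) B p)) =
        algebraMap (MvPolynomial (Fin n) L ⧸ IL)
          (Localization.AtPrime ((RingHom.ker (eval xbar) : Ideal (MvPolynomial (Fin n) L)).map (Ideal.Quotient.mk IL))) (G₁ p) := by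
  letI instDL := MvPolynomial.algebraMvPolynomial (σ := Fin n) (R := D) (S := L)
  obtain ⟨e, he⟩ := exists_swapEquiv (K := K) (n := n) (I := I) (𝔓 := 𝔓)
  set QL : Ideal (MvPolynomial (Fin n) L ⧸ IL) :=
    (RingHom.ker (eval xbar) : Ideal (MvPolynomial (Fin n) L)).map (Ideal.Quotient.mk IL) with hQLdef
  set Lv := Localization.AtPrime QL
  -- the point `x̄` on `W = D[X]/I_D`
  set QW : Ideal (MvPolynomial (Fin n) D ⧸ ID) :=
    (RingHom.ker (eval₂Hom (algebraMap D L) xbar)).map (Ideal.Quotient.mk ID) with hQW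
  have hQWker : QW = RingHom.ker (Ideal.Quotient.lift ID (eval₂Hom (algebraMap D L) xbar)
      (fun _ hq => map_le_ker_eval₂Hom hI𝔓 L hq)) := by
    rw [hQW, Ideal.ker_quotient_lift]
  haveI hQWp : QW.IsPrime := by rw [hQWker]; exact RingHom.ker_isPrime _
  haveI : IsLocalization ((nonZeroDivisors D).map (C : D →+* MvPolynomial (Fin n) D)) (MvPolynomial (Fin n) L) :=
    MvPolynomial.isLocalization _ _
  haveI hWloc : IsLocalization (Algebra.algebraMapSubmonoid (MvPolynomial (Fin n) D ⧸ ID)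
      ((nonZeroDivisors D).map (C : D →+* MvPolynomial (Fin n) D))) (MvPolynomial (Fin n) L ⧸ IL) := inferInstance
  haveI hLv : IsLocalization.AtPrime Lv (QL.comap (algebraMap (MvPolynomial (Fin n) D ⧸ ID) (MvPolynomial (Fin n) L ⧸ IL))) :=
    IsLocalization.isLocalization_isLocalization_atPrime_isLocalization
      (Algebra.algebraMapSubmonoid (MvPolynomial (Fin n) D ⧸ ID) ((nonZeroDivisors D).map (C : D →+* MvPolynomial (Fin n) D)))
      Lv QL
  have hQLW : QL.comap (algebraMap (MvPolynomial (Fin n) D ⧸ ID) (MvPolynomial (Fin n) L ⧸ IL)) = QW := by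
    refine Ideal.comap_injective_of_surjective (Ideal.Quotient.mk ID) Ideal.Quotient.mk_surjective ?_
    have hcomp : (algebraMap (MvPolynomial (Fin n) D ⧸ ID) (MvPolynomial (Fin n) L ⧸ IL)).comp (Ideal.Quotient.mk ID) =
        (Ideal.Quotient.mk IL).comp (algebraMap (MvPolynomial (Fin n) D) (MvPolynomial (Fin n) L)) := by
      refine RingHom.ext fun p => ?_
      rfl
    rw [Ideal.comap_comap, hcomp, ← Ideal.comap_comap, hQLdef, Ideal.comap_map_of_surjective _ Ideal.Quotient.mk_surjective,
      ← RingHom.ker_eq_comap_bot, Ideal.mk_ker, hQW, Ideal.comap_map_of_surjective _ Ideal.Quotient.mk_surjective,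
      ← RingHom.ker_eq_comap_bot, Ideal.mk_ker, sup_eq_left.mpr (map_le_ker_eval₂Hom hI𝔓 L), ker_eval₂Hom_eq_comap_ker_eval L]
    have hILle : IL ≤ RingHom.ker (eval xbar) := by
      rw [Ideal.map_le_iff_le_comap, ← ker_eval₂Hom_eq_comap_ker_eval L]
      exact map_le_ker_eval₂Hom hI𝔓 L
    rw [sup_eq_left.mpr hILle]
  -- `B/E₂B` is the localization of `T[Y]/E₂` at `𝔔/E₂`
  haveI hE := isPrime_map_quotientMk_of_le (map_ι₂_le_thickeningPrime hI𝔓 L hQ)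
  haveI hBloc : IsLocalization.AtPrime (B ⧸ (E₂).map (algebraMap (MvPolynomial (Fin n) T) B))
      (Q.map (Ideal.Quotient.mk E₂)) :=
    isLocalization_atPrime_quotient_mapExt_of_le (map_ι₂_le_thickeningPrime hI𝔓 L hQ) B
  -- transport `Lv`'s structure along the swap `e`
  have hQ' : Q.map (Ideal.Quotient.mk E₂) =
      (QL.comap (algebraMap (MvPolynomial (Fin n) D ⧸ ID) (MvPolynomial (Fin n) L ⧸ IL))).comap e.toRingHom := by
    rw [hQLW]
    refine Ideal.comap_injective_of_surjective (Ideal.Quotient.mk E₂) Ideal.Quotient.mk_surjective ?_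
    rw [Ideal.comap_map_of_surjective _ Ideal.Quotient.mk_surjective, ← RingHom.ker_eq_comap_bot, Ideal.mk_ker,
      sup_eq_left.mpr (map_ι₂_le_thickeningPrime hI𝔓 L hQ), Ideal.comap_comap, he, hQWker, RingHom.comap_ker,
      lift_eval₂Hom_comp_swapFwd hI𝔓 L, hQ]
  letI algLv : Algebra (MvPolynomial (Fin n) T ⧸ E₂) Lv :=
    ((algebraMap (MvPolynomial (Fin n) D ⧸ ID) Lv).comp e.toRingHom).toAlgebra
  haveI : IsLocalization.AtPrime Lv (Q.map (Ideal.Quotient.mk E₂)) := isLocalization_atPrime_comap_of_ringEquiv e _ _ hQ'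
  refine ⟨(IsLocalization.algEquiv (Q.map (Ideal.Quotient.mk E₂)).primeCompl
    (B ⧸ (E₂).map (algebraMap (MvPolynomial (Fin n) T) B)) Lv).toRingEquiv, fun p => ?_⟩
  have h1 : Ideal.Quotient.mk ((E₂).map (algebraMap (MvPolynomial (Fin n) T) B)) (algebraMap (MvPolynomial (Fin n) T) B p) =
      algebraMap (MvPolynomial (Fin n) T ⧸ E₂) (B ⧸ (E₂).map (algebraMap (MvPolynomial (Fin n) T) B))
        (Ideal.Quotient.mk E₂ p) := rfl
  rw [h1]
  change (IsLocalization.algEquiv (Q.map (Ideal.Quotient.mk E₂)).primeCompl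
    (B ⧸ (E₂).map (algebraMap (MvPolynomial (Fin n) T) B)) Lv) _ = _
  rw [AlgEquiv.commutes]
  change ((algebraMap (MvPolynomial (Fin n) D ⧸ ID) Lv).comp e.toRingHom) (Ideal.Quotient.mk E₂ p) = _
  rw [RingHom.comp_apply, ← RingHom.comp_apply e.toRingHom (Ideal.Quotient.mk E₂) p, he,
    IsScalarTower.algebraMap_apply (MvPolynomial (Fin n) D ⧸ ID) (MvPolynomial (Fin n) L ⧸ IL) Lv]
  congr 1
  -- `(W → L[X]/I_L) ∘ f₁ = G₁` on `T[Y]`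
  have hcomp : (algebraMap (MvPolynomial (Fin n) D ⧸ ID) (MvPolynomial (Fin n) L ⧸ IL)).comp f₁ = G₁ := by
    refine ringHom_ext (fun t => ?_) (fun i => ?_)
    · obtain ⟨s, rfl⟩ := Ideal.Quotient.mk_surjective t
      rw [RingHom.comp_apply, coe_eval₂Hom, eval₂_C, Ideal.Quotient.lift_mk, RingHom.comp_apply, coe_eval₂Hom, eval₂_C,
        Ideal.Quotient.lift_mk, RingHom.comp_apply, ← MvPolynomial.map_map]
      rfl
    · rw [RingHom.comp_apply, coe_eval₂Hom, eval₂_X, coe_eval₂Hom, eval₂_X]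
      change Ideal.Quotient.mk IL (MvPolynomial.map (algebraMap D L) (C (Ideal.Quotient.mk 𝔓 (X i)))) = _
      rw [map_C]
  rw [← hcomp, RingHom.comp_apply]

end Structure

end CampaignW42

end Summit.ResolutionOfSingularities.ResolutionOfSingularities.Theorems

end
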